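import Literature.NumberTheory.Rogawski1990.CMCharIdentityClauses
import Literature.NumberTheory.GelbartRogawski1991.WeilLiftNonsplitPrincipalSeriesConstituent
import Literature.NumberTheory.Rogawski1990.CharIdentityOnTestFunctions        -- A-p19 (g21) T8-21 R1∕R2 FILE A: `LocalAPacket.CharIdentityAtTest` (the (13.1.4) identity on TEST functions)
import HarnessLib

/-!
# [Rogawski1990 Prop. 13.1.3 (d), 13.1.4; GelbartRogawski1991 Lem. 5.1.2] THE THETA-DOCKING CLAUSE — TEST-FUNCTION EDITION
# `CMThetaDockingClausesTest` ∕ `CMThetaDockingPackageTest` (the (13.1.4)-identity read on `C_c^∞`, i.e. on `IsLocSmooth` pairs)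

Topic `NumberTheory/Rogawski1990`; namespace `Literature.NumberTheory.Rogawski1990`.  DEFINITIONS WITH BODY ONLY (two `Prop`-valued predicates on GIVEN global data) + their
`Iff.rfl` unfoldings and one read-back; **no named fact (debt 0), no instance, no notation, no attribute, no `sorry`; this file ASSERTS NOTHING.**  Cell `hodgecm-mathlib`
(D-0151), crux H413; F0P2-p01 (g9), T8-21 Test-twin list extension (LEAD F0P3a-plan (g9) WORD T8-21; director g18 s759 (3); F0P2-p06 (g5) FINDING 2026-09-01T02:33:19Z
`F0/P2/F0P2-p06/g5/FINDING-DOCK-Db-JUNK.F0P2p06g5.md` + certificate 036dd34ca96978fb; F0P2-ref1 (g5) r241 ④).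

WHY A TEST EDITION.  ★ `CMThetaDockingClauses` (this directory, unchanged — kept as the negative edge) takes, for every supercuspidal candidate `πs`, the character identity
★ `LocalAPacket.CharIdentityAt ⟨πⁿ ∘ e, some πs⟩ (tr := smoothTrace)` as a HYPOTHESIS.  That predicate quantifies the identity over ALL bare functions `f : G′_v → ℂ`; since
★ `IrrClass.smoothTrace` is junk `0` off the test functions and the matching relation ★ `IsLocalDeltaTransfer` only sees orbital integrals at regular norm classes, the identity
forces every matched trace sum to vanish (★ `charIdentityAt_forces_zero`, `Cruxes/H413/Lines/F0_P3b_QCMJunkObstruction.lean`; ★ p840152) — so at genuine (Haar) data the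
hypothesis is never met and the docking clause is VACUOUSLY TRUE (F0P2-p06 (g5) §1 `cmThetaDockingClauses_of_nondiscrete_of_witness`).  Print's (13.1.4) is an identity of
distributions on `C_c^∞(G_v)` [Rogawski1990 §13.1 p. 199; §4.3].  This edition is the SAME text with EXACTLY ONE token changed: the hypothesis is ★
`LocalAPacket.CharIdentityAtTest` (A-p19 (g21), `CharIdentityOnTestFunctions.lean`: the identity for `Δ_v`-matching pairs `(f^H_v, f_v)` of TEST functions, `IsLocSmooth fH ∧ IsLocSmooth f`),
under which the docking clause says what print says: «every supercuspidal `πs ≠ πⁿ ∘ e` completing `πⁿ ∘ e` in (13.1.4) ON TEST FUNCTIONS is a `U(1)`-theta type» [GR91 Lem. 5.1.2].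
Binder blocks are byte-identical to ★ `CMThetaDockingClauses` ∕ `CMThetaDockingPackage` (the `set_option … in` heartbeat bumps and `autoImplicit false` of the original are
dropped — not needed, and the statement-only lane admits no `set_option`); consumers re-point by one token (`…Clauses ↦ …ClausesTest`).  No bridge lemma OLD ⇒ NEW
(the old hypothesis is never met at Haar data; the implication `CMThetaDockingClausesTest → CMThetaDockingClauses` holds trivially there but is worthless and not stated).

* `CMThetaDockingClausesTest L H Δ mH mG νH νG ξ μω ξloc e₁ dV hdV hdV0 g hg` — as ★ `CMThetaDockingClauses`, hypothesis on `CharIdentityAtTest`.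
* `CMThetaDockingPackageTest L H νH νG μω e₁ dV hdV hdV0 g hg Δ mH mG` — `∀ ξ`, the clauses at `ξloc := ξ.xiLocalChar` BY NAME.
* `cmThetaDockingClausesTest_iff`, `cmThetaDockingPackageTest_iff` (`Iff.rfl`); read-back `CMThetaDockingPackageTest.clauses`.

## References
* [Rogawski1990] J. Rogawski, *Automorphic Representations of Unitary Groups in Three Variables*, Ann. of Math. Stud. 123 (1990): §12.2 (2) p. 174; §13.1 p. 199
  (Prop. 13.1.3 (d), Prop. 13.1.4, the A-packet `Π(ξ)`); §4.3 p. 43 (identities of distributions on `C_c^∞`); §4.9 pp. 54–55.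
* [GelbartRogawski1991] S. Gelbart, J. Rogawski, Invent. Math. 105 (1991): §1.4 pp. 450–451; Lem. 5.1.2 p. 466; Remark p. 466.
* [Rogawski1992] J. Rogawski, *The multiplicity formula for A-packets*, CRM Montréal (1992) 395–419: Thm. 1.1 p. 396.
-/


noncomputable section

open NumberField IsDedekindDomain MeasureTheory
open scoped Matrix ComplexOrder

namespace Literature.NumberTheory.Rogawski1990

open Literature.NumberTheory Literature.NumberTheory.Automorphic Literature.NumberTheory.Automorphic.UnitaryGroup
open Literature.NumberTheory.Automorphic.IdeleClassGroup
open Literature.NumberTheory.Automorphic.Liu2021 Literature.NumberTheory.Automorphic.Liu2021.Def411WeilCarriers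
open Literature.NumberTheory.GaloisRepresentations
open Literature.NumberTheory.GelbartRogawski1991

section Clauses

variable (L : Type) [Field L] [NumberField L] [IsCMField L] (H : Matrix (Fin 3) (Fin 3) L)
  (hH : (H.map (cmConjRingHom L))ᵀ = H) (hHd : IsUnit H.det)

/-- **The theta-docking clause of the joint letter — TEST-FUNCTION EDITION [Rogawski1990 Prop. 13.1.3 (d), 13.1.4; GelbartRogawski1991 Lem. 5.1.2] on GIVEN data** (hypothesis = the (13.1.4) identity ON TEST FUNCTIONS, ★ `LocalAPacket.CharIdentityAtTest`; T8-21).  For the global transfer data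
`(Δ_v, m_{H,v}, m_{G,v})_v`, Haar families `ν_H, ν_G`, the character `ξ` of `H`, Rogawski's `μ = μω`, the local characters `ξ_v = ξloc v`, and a rational theta frame
`ᵗ(c̄ g) H g = diag dV`: for every pair `(μ, χ_f)` (`μ` conjugate-symplectic, `χ_f` a continuous unitary character of `U(1)(𝔸_{L⁺,f})`) on letter #76's two DICTIONARY
equations, at every finite `v` of `L⁺` that does not split in `L`, for every form congruence `ᵗT̄·H_v·T = a·Φ₃`, every Haar measure `μZ` on `U(Φ₃)(L⁺_v) ⧸ Z`, every
Keys-labelled pair `(π², πⁿ)` of `JH(i_G(χ_ξ))` with `πⁿ` NOT square-integrable (so `πⁿ = πⁿ(ξ_v)`), and every SUPERCUSPIDAL class `πs ≠ πⁿ ∘ e` of `U(H)(L⁺_v)` such that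
the packet `⟨πⁿ ∘ e, some πs⟩` satisfies the character identity (13.1.4) for this data: `πs` is the local theta type `X_v(μ, ε, χ_f) ∘ κ_v⁻¹` (★ `ThetaTypeAtCM`) for some
line class `ε` — «`πˢ(ξ_v) = ω(γ_v, ψ′_v, χ_v)` for the other class of `ψ′_v`».  A PREDICATE: print-true for Rogawski's canonical transfer data (where the witness `πs` is
unique and is GR91's supercuspidal Weil representation), meaningless for twisted∕degenerate `Δ` — to be asserted only INSIDE the joint existential of ★
`GlobalTransferWithCMCharIdentities` (its owner's edition), never free-standing.
[cite: Rogawski1990, §13.1 Prop. 13.1.3 (d), Prop. 13.1.4 p. 199; §12.2 (2) p. 174] [cite: GelbartRogawski1991, Lem. 5.1.2 p. 466; §1.4 pp. 450–451] -/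
def CMThetaDockingClausesTest
    [∀ v : HeightOneSpectrum (𝓞 ↥(maximalRealSubfield L)), MeasurableSpace ((cmDatum L 3 H).Local v)]
    [∀ v : HeightOneSpectrum (𝓞 ↥(maximalRealSubfield L)),
      MeasurableSpace ((cmDatum L 2 (Matrix.of fun i j : Fin 2 => if i.val + j.val + 1 = 2 then (1 : L) else 0)).Local v ×
        (cmDatum L 1 (Matrix.of fun i j : Fin 1 => if i.val + j.val + 1 = 1 then (1 : L) else 0)).Local v)]
    [∀ (v : HeightOneSpectrum (𝓞 ↥(maximalRealSubfield L)))
        (a : ((cmDatum L 2 (Matrix.of fun i j : Fin 2 => if i.val + j.val + 1 = 2 then (1 : L) else 0)).Local v ×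
          (cmDatum L 1 (Matrix.of fun i j : Fin 1 => if i.val + j.val + 1 = 1 then (1 : L) else 0)).Local v)),
      MeasurableSpace (((cmDatum L 2 (Matrix.of fun i j : Fin 2 => if i.val + j.val + 1 = 2 then (1 : L) else 0)).Local v ×
          (cmDatum L 1 (Matrix.of fun i j : Fin 1 => if i.val + j.val + 1 = 1 then (1 : L) else 0)).Local v) ⧸
        Subgroup.centralizer ({a} : Set ((cmDatum L 2 (Matrix.of fun i j : Fin 2 => if i.val + j.val + 1 = 2 then (1 : L) else 0)).Local v ×
          (cmDatum L 1 (Matrix.of fun i j : Fin 1 => if i.val + j.val + 1 = 1 then (1 : L) else 0)).Local v)))]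
    [∀ (v : HeightOneSpectrum (𝓞 ↥(maximalRealSubfield L))) (γ : (cmDatum L 3 H).Local v),
      MeasurableSpace ((cmDatum L 3 H).Local v ⧸ Subgroup.centralizer ({γ} : Set ((cmDatum L 3 H).Local v)))]
    (Δ : ∀ v : HeightOneSpectrum (𝓞 ↥(maximalRealSubfield L)), LocalTransferFactor L H v)
    (mH : ∀ v : HeightOneSpectrum (𝓞 ↥(maximalRealSubfield L)),
      OrbitalMeasureFamily ((cmDatum L 2 (Matrix.of fun i j : Fin 2 => if i.val + j.val + 1 = 2 then (1 : L) else 0)).Local v ×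
        (cmDatum L 1 (Matrix.of fun i j : Fin 1 => if i.val + j.val + 1 = 1 then (1 : L) else 0)).Local v))
    (mG : ∀ v : HeightOneSpectrum (𝓞 ↥(maximalRealSubfield L)), OrbitalMeasureFamily ((cmDatum L 3 H).Local v))
    (νH : ∀ v : HeightOneSpectrum (𝓞 ↥(maximalRealSubfield L)),
      Measure ((cmDatum L 2 (Matrix.of fun i j : Fin 2 => if i.val + j.val + 1 = 2 then (1 : L) else 0)).Local v ×
        (cmDatum L 1 (Matrix.of fun i j : Fin 1 => if i.val + j.val + 1 = 1 then (1 : L) else 0)).Local v))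
    (νG : ∀ v : HeightOneSpectrum (𝓞 ↥(maximalRealSubfield L)), Measure ((cmDatum L 3 H).Local v))
    (ξ : OneDimAutRepH L) (μω : HeckeCharacter L)
    (ξloc : ∀ v : HeightOneSpectrum (𝓞 ↥(maximalRealSubfield L)),
      (cmDatum L 2 (Matrix.of fun i j : Fin 2 => if i.val + j.val + 1 = 2 then (1 : L) else 0)).Local v ×
        (cmDatum L 1 (Matrix.of fun i j : Fin 1 => if i.val + j.val + 1 = 1 then (1 : L) else 0)).Local v →* ℂˣ)
    {n' : ℕ} (e₁ : Fin 3 × Fin 1 ≃ Fin n') (dV : Fin 3 → L) (hdV : ∀ i, IsCMField.complexConj L (dV i) = dV i) (hdV0 : ∀ i, dV i ≠ 0) (g : GL (Fin 3) L)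
    (hg : ((g : Matrix (Fin 3) (Fin 3) L).map (cmConjRingHom L))ᵀ * H * (g : Matrix (Fin 3) (Fin 3) L) = Matrix.diagonal dV) : Prop :=
  ∀ (μ : Literature.NumberTheory.Automorphic.IdeleClassGroup L →ₜ* Circle) (hμ : IsConjugateSymplectic L μ)
    (χf : UnitaryGroup.finAdelicOne (↥(maximalRealSubfield L)) L (IsCMField.complexConj L) →* ℂˣ),
    Continuous χf → (∀ z, ‖((χf z : ℂˣ) : ℂ)‖ = 1) →
    -- DICTIONARY (μ): `μ̃ = η̃⁻¹ · ψ̃⁻¹ · μω`, semi-locally at every finite place of `L⁺` (verbatim from #76)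
    (∀ v : HeightOneSpectrum (𝓞 ↥(maximalRealSubfield L)),
        (toHeckeCharacter L μ).semilocalComponent L v = (ξ.bcη⁻¹ * ξ.bcψ⁻¹ * μω).semilocalComponent L v) →
    -- DICTIONARY (χ_f): `χ_f (z / z̄) = (ψ̃⁻¹ · (η̃⁻¹ ψ̃⁻¹ μω)²) ((1_∞, z))` for every finite idèle `z` of `L` (verbatim from #76)
    (∀ z : (FiniteAdeleRing (𝓞 L) L)ˣ,
        χf (finAdelicCheck (↥(maximalRealSubfield L)) L (IsCMField.complexConj L)
            (AlgEquiv.ext fun x => by rw [AlgEquiv.mul_apply, IsCMField.complexConj_apply_apply, AlgEquiv.one_apply]) z) =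
          (ξ.bcψ⁻¹ * (ξ.bcη⁻¹ * ξ.bcψ⁻¹ * μω) ^ 2)
            (Units.map (N := AdeleRing (𝓞 L) L) (MonoidHom.inr (InfiniteAdeleRing L) (FiniteAdeleRing (𝓞 L) L)) z)) →
    ∀ (v : HeightOneSpectrum (𝓞 ↥(maximalRealSubfield L))),
      (∀ w : PlacesOver L v, IsCMField.complexConj L • w.1 = w.1) →
      ∀ (T : GL (Fin 3) (LocalRing L v)) (a : LocalRing L v) (ha : IsUnit a)
        (h : formCongr (conjLocal L (IsCMField.complexConj L) v) T (H.map (algebraMap L (LocalRing L v))) =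
          a • (Matrix.of fun i j : Fin 3 => if i.val + j.val + 1 = 3 then (1 : L) else 0).map (algebraMap L (LocalRing L v))),
      ∀ [MeasurableSpace (Gqs L v ⧸ Subgroup.center (Gqs L v))] [BorelSpace (Gqs L v ⧸ Subgroup.center (Gqs L v))]
        (μZ : Measure (Gqs L v ⧸ Subgroup.center (Gqs L v))) [μZ.IsHaarMeasure],
      ∀ (π2 πn : IrrClass (Gqs L v)),
        KeysCaseTwoLabels L v (μω.semilocalComponent L v) (torusLocalComponent L (IsCMField.complexConj L) v ξ.η)
          (torusLocalComponent L (IsCMField.complexConj L) v ξ.ψ) π2 πn →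
        ¬ πn.IsSquareIntegrable μZ →
        ∀ (πs : IrrClass ((cmDatum L 3 H).Local v)), πs.IsSupercuspidal →
          πs ≠ IrrClass.comap (cmDatumLocalCongr L v T ha h).symm πn →
          (⟨IrrClass.comap (cmDatumLocalCongr L v T ha h).symm πn, some πs⟩ : CMLocalAPacket L H v).CharIdentityAtTest L H v
              (fun c f => c.smoothTrace (νG v) f) (ξloc v) (νH v) (Δ v) (mH v) (mG v) →
          ∃ ε : (↥(maximalRealSubfield L))ˣ, ThetaTypeAtCM L H e₁ dV hdV hdV0 g hg μ hμ χf ε v πs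

/-- **The `Q`-shaped theta-docking package** (currency of ★ `CMCharIdentityPackage`): for the global data `(Δ_v, m_{H,v}, m_{G,v})_v`, the clauses
`CMThetaDockingClausesTest` for EVERY global character `ξ` of `H` at the local characters `ξ_v = ξ.xiLocalChar v` BY NAME, for the given frame.  Intended use: the joint
letter's owner conjoins it, `Q := fun Δ mH mG => CMCharIdentityPackage … Δ mH mG ∧ CMThetaDockingPackageTest … Δ mH mG`.
[cite: Rogawski1990, §13.1 Prop. 13.1.4 p. 199] [cite: GelbartRogawski1991, Lem. 5.1.2 p. 466] -/
def CMThetaDockingPackageTest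
    [∀ v : HeightOneSpectrum (𝓞 ↥(maximalRealSubfield L)), MeasurableSpace ((cmDatum L 3 H).Local v)]
    [∀ v : HeightOneSpectrum (𝓞 ↥(maximalRealSubfield L)),
      MeasurableSpace ((cmDatum L 2 (Matrix.of fun i j : Fin 2 => if i.val + j.val + 1 = 2 then (1 : L) else 0)).Local v ×
        (cmDatum L 1 (Matrix.of fun i j : Fin 1 => if i.val + j.val + 1 = 1 then (1 : L) else 0)).Local v)]
    [∀ (v : HeightOneSpectrum (𝓞 ↥(maximalRealSubfield L)))
        (a : ((cmDatum L 2 (Matrix.of fun i j : Fin 2 => if i.val + j.val + 1 = 2 then (1 : L) else 0)).Local v ×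
          (cmDatum L 1 (Matrix.of fun i j : Fin 1 => if i.val + j.val + 1 = 1 then (1 : L) else 0)).Local v)),
      MeasurableSpace (((cmDatum L 2 (Matrix.of fun i j : Fin 2 => if i.val + j.val + 1 = 2 then (1 : L) else 0)).Local v ×
          (cmDatum L 1 (Matrix.of fun i j : Fin 1 => if i.val + j.val + 1 = 1 then (1 : L) else 0)).Local v) ⧸
        Subgroup.centralizer ({a} : Set ((cmDatum L 2 (Matrix.of fun i j : Fin 2 => if i.val + j.val + 1 = 2 then (1 : L) else 0)).Local v ×
          (cmDatum L 1 (Matrix.of fun i j : Fin 1 => if i.val + j.val + 1 = 1 then (1 : L) else 0)).Local v)))]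
    [∀ (v : HeightOneSpectrum (𝓞 ↥(maximalRealSubfield L))) (γ : (cmDatum L 3 H).Local v),
      MeasurableSpace ((cmDatum L 3 H).Local v ⧸ Subgroup.centralizer ({γ} : Set ((cmDatum L 3 H).Local v)))]
    (νH : ∀ v : HeightOneSpectrum (𝓞 ↥(maximalRealSubfield L)),
      Measure ((cmDatum L 2 (Matrix.of fun i j : Fin 2 => if i.val + j.val + 1 = 2 then (1 : L) else 0)).Local v ×
        (cmDatum L 1 (Matrix.of fun i j : Fin 1 => if i.val + j.val + 1 = 1 then (1 : L) else 0)).Local v))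
    (νG : ∀ v : HeightOneSpectrum (𝓞 ↥(maximalRealSubfield L)), Measure ((cmDatum L 3 H).Local v))
    (μω : HeckeCharacter L)
    {n' : ℕ} (e₁ : Fin 3 × Fin 1 ≃ Fin n') (dV : Fin 3 → L) (hdV : ∀ i, IsCMField.complexConj L (dV i) = dV i) (hdV0 : ∀ i, dV i ≠ 0) (g : GL (Fin 3) L)
    (hg : ((g : Matrix (Fin 3) (Fin 3) L).map (cmConjRingHom L))ᵀ * H * (g : Matrix (Fin 3) (Fin 3) L) = Matrix.diagonal dV) :
    (∀ v : HeightOneSpectrum (𝓞 ↥(maximalRealSubfield L)), LocalTransferFactor L H v) →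
    (∀ v : HeightOneSpectrum (𝓞 ↥(maximalRealSubfield L)),
      OrbitalMeasureFamily ((cmDatum L 2 (Matrix.of fun i j : Fin 2 => if i.val + j.val + 1 = 2 then (1 : L) else 0)).Local v ×
        (cmDatum L 1 (Matrix.of fun i j : Fin 1 => if i.val + j.val + 1 = 1 then (1 : L) else 0)).Local v)) →
    (∀ v : HeightOneSpectrum (𝓞 ↥(maximalRealSubfield L)), OrbitalMeasureFamily ((cmDatum L 3 H).Local v)) → Prop :=
  fun Δ mH mG => ∀ ξ : OneDimAutRepH L, CMThetaDockingClausesTest L H Δ mH mG νH νG ξ μω (fun v => ξ.xiLocalChar v) e₁ dV hdV hdV0 g hg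

variable {L H}
variable
  [∀ v : HeightOneSpectrum (𝓞 ↥(maximalRealSubfield L)), MeasurableSpace ((cmDatum L 3 H).Local v)]
  [∀ v : HeightOneSpectrum (𝓞 ↥(maximalRealSubfield L)),
    MeasurableSpace ((cmDatum L 2 (Matrix.of fun i j : Fin 2 => if i.val + j.val + 1 = 2 then (1 : L) else 0)).Local v ×
      (cmDatum L 1 (Matrix.of fun i j : Fin 1 => if i.val + j.val + 1 = 1 then (1 : L) else 0)).Local v)]
  [∀ (v : HeightOneSpectrum (𝓞 ↥(maximalRealSubfield L)))
      (a : ((cmDatum L 2 (Matrix.of fun i j : Fin 2 => if i.val + j.val + 1 = 2 then (1 : L) else 0)).Local v ×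
        (cmDatum L 1 (Matrix.of fun i j : Fin 1 => if i.val + j.val + 1 = 1 then (1 : L) else 0)).Local v)),
    MeasurableSpace (((cmDatum L 2 (Matrix.of fun i j : Fin 2 => if i.val + j.val + 1 = 2 then (1 : L) else 0)).Local v ×
        (cmDatum L 1 (Matrix.of fun i j : Fin 1 => if i.val + j.val + 1 = 1 then (1 : L) else 0)).Local v) ⧸
      Subgroup.centralizer ({a} : Set ((cmDatum L 2 (Matrix.of fun i j : Fin 2 => if i.val + j.val + 1 = 2 then (1 : L) else 0)).Local v ×
        (cmDatum L 1 (Matrix.of fun i j : Fin 1 => if i.val + j.val + 1 = 1 then (1 : L) else 0)).Local v)))]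
  [∀ (v : HeightOneSpectrum (𝓞 ↥(maximalRealSubfield L))) (γ : (cmDatum L 3 H).Local v),
    MeasurableSpace ((cmDatum L 3 H).Local v ⧸ Subgroup.centralizer ({γ} : Set ((cmDatum L 3 H).Local v)))]
  {Δ : ∀ v : HeightOneSpectrum (𝓞 ↥(maximalRealSubfield L)), LocalTransferFactor L H v}
  {mH : ∀ v : HeightOneSpectrum (𝓞 ↥(maximalRealSubfield L)),
    OrbitalMeasureFamily ((cmDatum L 2 (Matrix.of fun i j : Fin 2 => if i.val + j.val + 1 = 2 then (1 : L) else 0)).Local v ×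
      (cmDatum L 1 (Matrix.of fun i j : Fin 1 => if i.val + j.val + 1 = 1 then (1 : L) else 0)).Local v)}
  {mG : ∀ v : HeightOneSpectrum (𝓞 ↥(maximalRealSubfield L)), OrbitalMeasureFamily ((cmDatum L 3 H).Local v)}
  {νH : ∀ v : HeightOneSpectrum (𝓞 ↥(maximalRealSubfield L)),
    Measure ((cmDatum L 2 (Matrix.of fun i j : Fin 2 => if i.val + j.val + 1 = 2 then (1 : L) else 0)).Local v ×
      (cmDatum L 1 (Matrix.of fun i j : Fin 1 => if i.val + j.val + 1 = 1 then (1 : L) else 0)).Local v)}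
  {νG : ∀ v : HeightOneSpectrum (𝓞 ↥(maximalRealSubfield L)), Measure ((cmDatum L 3 H).Local v)}
  {μω : HeckeCharacter L}
  {n' : ℕ} {e₁ : Fin 3 × Fin 1 ≃ Fin n'} {dV : Fin 3 → L} {hdV : ∀ i, IsCMField.complexConj L (dV i) = dV i} {hdV0 : ∀ i, dV i ≠ 0} {g : GL (Fin 3) L}
  {hg : ((g : Matrix (Fin 3) (Fin 3) L).map (cmConjRingHom L))ᵀ * H * (g : Matrix (Fin 3) (Fin 3) L) = Matrix.diagonal dV}

/-- Read-back: the package gives the clauses at every `ξ`, at `ξloc := ξ.xiLocalChar`. [cite: Rogawski1990, §13.1 Prop. 13.1.4 p. 199] -/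
theorem CMThetaDockingPackageTest.clauses (hQ : CMThetaDockingPackageTest L H νH νG μω e₁ dV hdV hdV0 g hg Δ mH mG) (ξ : OneDimAutRepH L) :
    CMThetaDockingClausesTest L H Δ mH mG νH νG ξ μω (fun v => ξ.xiLocalChar v) e₁ dV hdV hdV0 g hg :=
  hQ ξ

/-- Unfolding of `CMThetaDockingPackageTest`. [cite: Rogawski1990, §13.1 Prop. 13.1.4 p. 199] -/
theorem cmThetaDockingPackageTest_iff :
    CMThetaDockingPackageTest L H νH νG μω e₁ dV hdV hdV0 g hg Δ mH mG ↔
      ∀ ξ : OneDimAutRepH L, CMThetaDockingClausesTest L H Δ mH mG νH νG ξ μω (fun v => ξ.xiLocalChar v) e₁ dV hdV hdV0 g hg :=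
  Iff.rfl

end Clauses

end Literature.NumberTheory.Rogawski1990

end
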